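import Summits.KontsevichZagierPeriods.KontsevichZagierPeriods.Theorems.FermatIsogenyDeepWordSectorP06

/-! # `FermatIsogenyDeepWordSectorP07` — part 7/11 of the mechanical ≤400-line split of `DeepWordSector.lean` (sha256 5e8cd5c1c920648a…)
Source: decomp-kz lens-5 g22 DeepWordSector.lean v10 @5e8cd5c1 (the deep Beta-word sector node: bridge S ⟺ BetaWordTower ∧ WordSectorComplete, finite boxes, box ladder, shadow arithmetic, Chudnovsky levels; critic CLEARED g6-2/3/4/11/13/16/19); --supports stmt-KontsevichZagierPeriods-3898.
Split by census-1 g10 `gen/splitlean.py`: scopes re-opened with their `open`/`variable`/`set_option` context; mathematics and declaration order unchanged. -/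

namespace Summit.KontsevichZagierPeriods.FermatIsogeny.DeepTargets
open Literature.NumberTheory.Transcendental MeasureTheory
open Summit.KontsevichZagierPeriods.KontsevichZagierPeriods.Theses.FermatIsogeny (BetaLinearSector BetaProductSector FermatSectorComplete)

/-! ### Letter values `B(a,b) = Γ(a)Γ(b)/Γ(a+b)` and word values -/

/-- The real value of the letter `β(a,b)`: `bval a b = evalP (bcl a b)` (`= B(a,b)` for `0 < a, b`; junk `1` otherwise). [bookkeeping] -/
noncomputable def bval (a b : ℚ) : ℝ := KZ.evalP (bcl a b)

/-- Transfer of a set integral along the evaluation `(Fin 1 → ℝ) ≃ᵐ ℝ`. [folklore] -/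
private theorem setIntegral_fin_one (f : ℝ → ℝ) (S : Set ℝ) :
    ∫ x in {x : Fin 1 → ℝ | x 0 ∈ S}, f (x 0) = ∫ t in S, f t := by
  have hS : {x : Fin 1 → ℝ | x 0 ∈ S} = (MeasurableEquiv.funUnique (Fin 1) ℝ) ⁻¹' S := by
    ext x; exact Iff.rfl
  rw [hS]
  exact (volume_preserving_funUnique (Fin 1) ℝ).setIntegral_preimage_emb
    (MeasurableEquiv.measurableEmbedding _) f S

/-- The slab `{x : ℝ¹ | x₀ ∈ (0,1)}` is measurable. [bookkeeping] -/
private theorem measurableSet_slab₁ : MeasurableSet {x : Fin 1 → ℝ | x 0 ∈ Set.Ioo (0:ℝ) 1} :=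
  measurableSet_Ioo.preimage (measurable_pi_apply 0)

/-- **Euler's Beta integral**: `bval a b = Γ(a)Γ(b)/Γ(a+b)` for rational `a, b > 0`
(`Literature.Analysis.SpecialFunctions.Selberg.integrableOn_Ioo_rpow_mul_one_sub_rpow_and_integral_eq`). (cite AndrewsAskeyRoy1999, Thm 1.1.4) -/
theorem bval_eq {a b : ℚ} (ha : 0 < a) (hb : 0 < b) :
    bval a b = Real.Gamma a * Real.Gamma b / Real.Gamma ((a:ℝ) + b) := by
  have haR : (0:ℝ) < a := by exact_mod_cast ha
  have hbR : (0:ℝ) < b := by exact_mod_cast hb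
  rw [bval, bcl_eq ha hb, KZ.evalP_toFormalPeriod_of]; show ∫ x in (bRep a b ha hb).domain, (bRep a b ha hb).integrand x = _
  rw [setIntegral_congr_fun ((bRep_domain a b ha hb) ▸ measurableSet_slab₁) (bRep_integrand a b ha hb), bRep_domain]
  exact (setIntegral_fin_one (fun t => t ^ ((a:ℝ) - 1) * (1 - t) ^ ((b:ℝ) - 1)) (Set.Ioo 0 1)).trans
    (Literature.Analysis.SpecialFunctions.Selberg.integrableOn_Ioo_rpow_mul_one_sub_rpow_and_integral_eq haR hbR).2

/-- `B(a,b) > 0` for `a, b > 0`. [folklore] -/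
theorem bval_pos {a b : ℚ} (ha : 0 < a) (hb : 0 < b) : 0 < bval a b := by
  have haR : (0:ℝ) < a := by exact_mod_cast ha
  have hbR : (0:ℝ) < b := by exact_mod_cast hb
  rw [bval_eq ha hb]
  exact div_pos (mul_pos (Real.Gamma_pos_of_pos haR) (Real.Gamma_pos_of_pos hbR))
    (Real.Gamma_pos_of_pos (by linarith))

/-- **`B(½,½) = Γ(½)²/Γ(1) = π`.** (cite AndrewsAskeyRoy1999, (1.1.21)) -/
theorem bval_half_half : bval (1/2) (1/2) = Real.pi := by
  rw [bval_eq (by norm_num) (by norm_num)]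
  have h1 : (((1/2 : ℚ) : ℝ)) = 1/2 := by norm_num
  rw [h1, show (1/2 : ℝ) + 1/2 = 1 by norm_num, Real.Gamma_one, div_one, Real.Gamma_one_half_eq,
    Real.mul_self_sqrt Real.pi_pos.le]

/-- **The value of a cube word is the product of its letter values**: `value [(0,1)^k, ∏ x^{a-1}(1-x)^{b-1}] = ∏ B(aⱼ,bⱼ)`
(`word_class` read through `evalP`). (cite KontsevichZagier2001, §4.1) -/
theorem word_value {k : ℕ} (a b : Fin k → ℚ) (hab : ∀ j, 0 < a j ∧ 0 < b j) (r : KZ.IntegralRep k)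
    (hr : r.domain = {x | ∀ i, x i ∈ Set.Ioo (0:ℝ) 1})
    (hi : Set.EqOn r.integrand (fun x => ∏ i, (x i) ^ ((a i : ℝ) - 1) * (1 - x i) ^ ((b i : ℝ) - 1)) r.domain) :
    r.value = ∏ j, bval (a j) (b j) := by
  have h := congrArg KZ.evalP (word_class a b hab r hr hi); rwa [KZ.evalP_toFormalPeriod_of, map_prod] at h

/-- The same with an algebraic constant factor: `value [(0,1)^k, q ∏ …] = q ∏ B(aⱼ,bⱼ)`. (cite KontsevichZagier2001, §4.1) -/
theorem word_value_const {k : ℕ} (q : ℝ) (hq : IsAlgebraic ℚ q) (a b : Fin k → ℚ) (hab : ∀ j, 0 < a j ∧ 0 < b j)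
    (r : KZ.IntegralRep k) (hr : r.domain = {x | ∀ i, x i ∈ Set.Ioo (0:ℝ) 1})
    (hi : Set.EqOn r.integrand (fun x => q * ∏ i, (x i) ^ ((a i : ℝ) - 1) * (1 - x i) ^ ((b i : ℝ) - 1)) r.domain) :
    r.value = q * ∏ j, bval (a j) (b j) := by
  have h := congrArg KZ.evalP (word_class_const q hq a b hab r hr hi); rwa [KZ.evalP_toFormalPeriod_of, map_mul, evalP_kc, map_prod] at h

/-! ### The dichotomy along a pattern predicate: `Box(k,N) = Chain_T ∧ CoChain_T`, `Shadow_T ⇒ CoChain_T` -/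

/-- A predicate on level-`N` exponent patterns `(u,v;u',v')` of length `k`. [bookkeeping] -/
abbrev PatternPred (k N : ℕ) : Type :=
  (Fin k → Fin N) → (Fin k → Fin N) → (Fin k → Fin N) → (Fin k → Fin N) → Prop

/-- The value ratio of a pattern: `ρ(u,v;u',v') = ∏ᵢ B((uᵢ+1)/N,(vᵢ+1)/N) / ∏ᵢ B((u'ᵢ+1)/N,(v'ᵢ+1)/N)`. [this node] -/
noncomputable def ratio {k N : ℕ} (u v u' v' : Fin k → Fin N) : ℝ :=
  (∏ i, bval (lvl N u i) (lvl N v i)) / ∏ i, bval (lvl N u' i) (lvl N v' i)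

/-- **Chain part of the `(k,N)` box along `T`**: the box `BetaWordSectorLevel k N` restricted to `T`-patterns. [this node] -/
def BoxChain (k N : ℕ) (T : PatternPred k N) : Prop :=
  ∀ (u v u' v' : Fin k → Fin N), T u v u' v' → ∀ (q : ℝ), IsAlgebraic ℚ q → ∀ (r r' : KZ.IntegralRep k),
    r.domain = {x | ∀ i, x i ∈ Set.Ioo (0:ℝ) 1} →
    Set.EqOn r.integrand (fun x => ∏ i, (x i) ^ ((lvl N u i : ℝ) - 1) * (1 - x i) ^ ((lvl N v i : ℝ) - 1)) r.domain →
    r'.domain = {x | ∀ i, x i ∈ Set.Ioo (0:ℝ) 1} →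
    Set.EqOn r'.integrand (fun x => q * ∏ i, (x i) ^ ((lvl N u' i : ℝ) - 1) * (1 - x i) ^ ((lvl N v' i : ℝ) - 1))
      r'.domain →
    r.value = r'.value → KZ.Equivalent r r'

/-- **Transcendence shadow of the `(k,N)` box along `T`**: off `T` the value ratio is transcendental. [this node] -/
def BoxTranscendence (k N : ℕ) (T : PatternPred k N) : Prop :=
  ∀ (u v u' v' : Fin k → Fin N), ¬ T u v u' v' → Transcendental ℚ (ratio u v u' v')

/-- Auxiliary step `prod_bval_pos`: prod bval pos. [bookkeeping] -/
theorem prod_bval_pos {k N : ℕ} (hN : 0 < N) (u v : Fin k → Fin N) : 0 < ∏ i, bval (lvl N u i) (lvl N v i) :=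
  Finset.prod_pos fun i _ => bval_pos (lvl_bounds hN u i).1 (lvl_bounds hN v i).1

/-- Auxiliary step `ratio_pos`: ratio pos. [bookkeeping] -/
theorem ratio_pos {k N : ℕ} (hN : 0 < N) (u v u' v' : Fin k → Fin N) : 0 < ratio u v u' v' :=
  div_pos (prod_bval_pos hN u v) (prod_bval_pos hN u' v')

/-- **In a box instance the algebraic factor IS the value ratio**: `q = ρ(u,v;u',v')`. [this node] -/
theorem eq_ratio_of_value_eq {k N : ℕ} (hN : 0 < N) (u v u' v' : Fin k → Fin N) (q : ℝ) (hq : IsAlgebraic ℚ q)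
    (r r' : KZ.IntegralRep k)
    (hr : r.domain = {x | ∀ i, x i ∈ Set.Ioo (0:ℝ) 1})
    (hi : Set.EqOn r.integrand (fun x => ∏ i, (x i) ^ ((lvl N u i : ℝ) - 1) * (1 - x i) ^ ((lvl N v i : ℝ) - 1)) r.domain)
    (hr' : r'.domain = {x | ∀ i, x i ∈ Set.Ioo (0:ℝ) 1})
    (hi' : Set.EqOn r'.integrand
      (fun x => q * ∏ i, (x i) ^ ((lvl N u' i : ℝ) - 1) * (1 - x i) ^ ((lvl N v' i : ℝ) - 1)) r'.domain)
    (hv : r.value = r'.value) : q = ratio u v u' v' := by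
  have hab : ∀ j, 0 < lvl N u j ∧ 0 < lvl N v j := fun j => ⟨(lvl_bounds hN u j).1, (lvl_bounds hN v j).1⟩
  have hab' : ∀ j, 0 < lvl N u' j ∧ 0 < lvl N v' j := fun j => ⟨(lvl_bounds hN u' j).1, (lvl_bounds hN v' j).1⟩
  rw [word_value (lvl N u) (lvl N v) hab r hr hi, word_value_const q hq (lvl N u') (lvl N v') hab' r' hr' hi'] at hv; exact eq_div_of_mul_eq (prod_bval_pos hN u' v').ne' hv.symm

/-- **Chain ∧ shadow ⇒ box.** [this node] -/
theorem box_of_chain_of_transcendence {k N : ℕ} (hN : 0 < N) {T : PatternPred k N}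
    (hC : BoxChain k N T) (hT : BoxTranscendence k N T) : BetaWordSectorLevel k N := by
  intro u v u' v' q hq r r' hr hi hr' hi' hv; by_cases ht : T u v u' v'
  · exact hC u v u' v' ht q hq r r' hr hi hr' hi' hv
  · exact False.elim (hT u v u' v' ht
      (by rw [← eq_ratio_of_value_eq hN u v u' v' q hq r r' hr hi hr' hi' hv]; exact hq))

/-- **Box ⇒ chain** (restriction). [bookkeeping] -/
theorem boxChain_of_box {k N : ℕ} (T : PatternPred k N) (h : BetaWordSectorLevel k N) : BoxChain k N T :=
  fun u v u' v' _ => h u v u' v'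

end Summit.KontsevichZagierPeriods.FermatIsogeny.DeepTargets
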